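import Mathlib
import HarnessLib
import Summits.HubbardSuperconductivity.HubbardSuperconductivity.Theorems.WeakCouplingBCSKlLindhardEnclosureTip
import Summits.HubbardSuperconductivity.HubbardSuperconductivity.Theorems.WeakCouplingBCSKlLindhardEnclosureTipBox

/-!
# KL-MARGIN-SCAN reader (22) «kernel-lindhard-enclosure» — TIP RULE, the two abstract variants (outer `x` / outer `y`) (seat p4 g25)

`Params.tip_valid_outer_x` / `Params.tip_valid_outer_y`: on a cell `[a/U,b/U] × [c/U,d/U]`, for two energies `e₁, e₂` (abstract real functions with
`P.integrand ∘ pt ≤ 1/(|e₁| + |e₂|)`) whose scaled partials in the slice direction lie in interval boxes `Ym` (monotone one) and `Yo` (other one), with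
`|e₁| ≤ Uk/D` and the cross-slice bound `κ·|x − x†| ≤ |e₁| + |e₂|` (`κ = (J0/c²)/(2·Lmax/c)`), the kernel's `tipVariant Ym.absLo (max |Yo.lo| |Yo.hi|) dz B = some w`
gives `P.CeilValid a b c d w` (`tip_box_bound(_swap)` + `tip_rounding` + `tip_ceilValid_of_box`).  The four concrete variants of `Params.ceilTip` are the
instances `(e₁, e₂) = (ε_p − μ, ε_{p+q} − μ)` and its swap, in the two directions (next file).  Nothing here asserts `CeilTipSoundOrd` yet.
References: idea-4 r11 Core §3b (tree: `…LindhardEnclosureKernel`).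
-/

noncomputable section

set_option linter.dupNamespace false

namespace Summit.HubbardSuperconductivity.HubbardSuperconductivity.Theorems.KlLindhardEnclosure

open Real Set MeasureTheory Literature.MathematicalPhysics.QuantumLattice
open scoped ENNReal

/-- `(x, y) ↦ P.integrand (pt x y)` is measurable. [folklore] -/
theorem Params.measurable_integrand_pt (P : Params) : Measurable (Function.uncurry fun x y => P.integrand (pt x y)) := by
  have e : (Function.uncurry fun x y => P.integrand (pt x y)) =
      P.integrand ∘ (MeasurableEquiv.toLp 2 (Fin 2 → ℝ)) ∘ (MeasurableEquiv.finTwoArrow (α := ℝ)).symm := by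
    funext z; rfl
  rw [e]
  exact P.measurable_integrand.comp ((MeasurableEquiv.toLp 2 (Fin 2 → ℝ)).measurable.comp (MeasurableEquiv.finTwoArrow (α := ℝ)).symm.measurable)

/-- Unpacking `tipVariant = some w`. [folklore] -/
theorem Params.tipVariant_eq_some (P : Params) {v m dz B w : ℤ} (h : P.tipVariant v m dz B = some w) :
    0 < v ∧ 0 ≤ m ∧ 0 < dz ∧ w = cdivZ (2 ^ 31 * (v + m) * 10 ^ 4 * dz * B) (v ^ 2 * P.U) := by
  unfold Params.tipVariant at h
  split_ifs at h with hc
  · simp only [Option.some.injEq] at h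
    exact ⟨hc.1, hc.2.1, hc.2.2, h.symm⟩

/-- From a scaled enclosure with `absLo > 0`: the derivative is `≥ v` everywhere on the box or `≤ −v` everywhere (`v = absLo/c`). [folklore] -/
theorem mono_of_absLo_pos (I : IV) (hI : 0 < I.absLo) {S : Set (ℝ × ℝ)} {φ : ℝ → ℝ → ℝ}
    (h : ∀ p ∈ S, (I.lo : ℝ) ≤ 10 ^ 4 * 2 ^ 40 * φ p.1 p.2 ∧ 10 ^ 4 * 2 ^ 40 * φ p.1 p.2 ≤ (I.hi : ℝ)) :
    (∀ p ∈ S, (I.absLo : ℝ) / (10 ^ 4 * 2 ^ 40) ≤ φ p.1 p.2) ∨ (∀ p ∈ S, φ p.1 p.2 ≤ -((I.absLo : ℝ) / (10 ^ 4 * 2 ^ 40))) := by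
  rcases IV.absLo_pos_cases I hI with ⟨hlo, he⟩ | ⟨hhi, he⟩
  · left; intro p hp
    rw [he, div_le_iff₀ (by positivity)]
    have := (h p hp).1; linarith
  · right; intro p hp
    rw [he, Int.cast_neg, neg_div, neg_neg, le_div_iff₀ (by positivity)]
    have := (h p hp).2; linarith

section OuterX

variable (P : Params) {a b c d : ℤ}

/-- **Abstract tip variant, outer `x`** (slices in `y`; `e₁` the monotone energy). [folklore] -/
theorem Params.tip_valid_outer_x (hP : P.admissible = true) (hab : a < b) (hcd : c ≤ d)
    {e₁ e₂ e₁y e₂y : ℝ → ℝ → ℝ} (he₁ : ∀ x y, HasDerivAt (fun t => e₁ x t) (e₁y x y) y) (he₂ : ∀ x y, HasDerivAt (fun t => e₂ x t) (e₂y x y) y)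
    (hF : ∀ x y, P.integrand (pt x y) ≤ 1 / (|e₁ x y| + |e₂ x y|)) (Ym Yo : IV)
    (hYm : ∀ x ∈ Icc ((a : ℝ) / (P.U : ℝ)) ((b : ℝ) / (P.U : ℝ)), ∀ y ∈ Icc ((c : ℝ) / (P.U : ℝ)) ((d : ℝ) / (P.U : ℝ)),
      (Ym.lo : ℝ) ≤ 10 ^ 4 * 2 ^ 40 * e₁y x y ∧ 10 ^ 4 * 2 ^ 40 * e₁y x y ≤ (Ym.hi : ℝ))
    (hYo : ∀ x ∈ Icc ((a : ℝ) / (P.U : ℝ)) ((b : ℝ) / (P.U : ℝ)), ∀ y ∈ Icc ((c : ℝ) / (P.U : ℝ)) ((d : ℝ) / (P.U : ℝ)),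
      (Yo.lo : ℝ) ≤ 10 ^ 4 * 2 ^ 40 * e₂y x y ∧ 10 ^ 4 * 2 ^ 40 * e₂y x y ≤ (Yo.hi : ℝ))
    (Uk : ℤ) (hUk : ∀ x ∈ Icc ((a : ℝ) / (P.U : ℝ)) ((b : ℝ) / (P.U : ℝ)), ∀ y ∈ Icc ((c : ℝ) / (P.U : ℝ)) ((d : ℝ) / (P.U : ℝ)),
      |e₁ x y| ≤ (Uk : ℝ) / 2 ^ 40)
    (J0 Lmax : ℤ) (hJ0 : 0 < J0) (hL : 0 < Lmax) {xs : ℝ}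
    (hlow : ∀ x ∈ Icc ((a : ℝ) / (P.U : ℝ)) ((b : ℝ) / (P.U : ℝ)), ∀ y ∈ Icc ((c : ℝ) / (P.U : ℝ)) ((d : ℝ) / (P.U : ℝ)),
      (J0 : ℝ) / (2 * (10 ^ 4 * 2 ^ 40) * (Lmax : ℝ)) * |x - xs| ≤ |e₁ x y| + |e₂ x y|)
    {w : ℤ} (hw : P.tipVariant Ym.absLo (max |Yo.lo| |Yo.hi|) (b - a) (logUpZ (cdivZ (4 * Uk * Lmax * P.U * 10 ^ 4 * D) (J0 * (b - a))) + D) = some w) :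
    P.CeilValid a b c d w := by
  obtain ⟨-, -, hU, -, -⟩ := P.admissible_facts hP
  have hU' : (0 : ℝ) < (P.U : ℝ) := by exact_mod_cast hU
  obtain ⟨hv, hm, hdz, rfl⟩ := P.tipVariant_eq_some hw
  set cD : ℝ := 10 ^ 4 * 2 ^ 40 with hcD
  have hx : (a : ℝ) / (P.U : ℝ) < (b : ℝ) / (P.U : ℝ) := div_lt_div_of_pos_right (by exact_mod_cast hab) hU'
  have hcd' : (c : ℝ) / (P.U : ℝ) ≤ (d : ℝ) / (P.U : ℝ) := div_le_div_of_nonneg_right (by exact_mod_cast hcd) hU'.le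
  -- Uk ≥ 0 from the (nonempty) closed box
  have hUk0 : 0 ≤ Uk := by
    have h := hUk _ (left_mem_Icc.2 hx.le) _ (left_mem_Icc.2 hcd')
    have : (0 : ℝ) ≤ (Uk : ℝ) / 2 ^ 40 := le_trans (abs_nonneg _) h
    have : (0 : ℝ) ≤ (Uk : ℝ) := by
      have := mul_nonneg this (by positivity : (0:ℝ) ≤ 2 ^ 40); simpa using this
    exact_mod_cast this
  have hround := tip_rounding (U := P.U) hv hm hdz hU hJ0 hL hUk0
  -- the real bound is nonnegative ⇒ w ≥ 0 (degenerate case)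
  have hv' : (0 : ℝ) < (Ym.absLo : ℝ) := by exact_mod_cast hv
  have hm' : (0 : ℝ) ≤ ((max |Yo.lo| |Yo.hi| : ℤ) : ℝ) := by exact_mod_cast hm
  have hdz' : (0 : ℝ) < ((b - a : ℤ) : ℝ) := by exact_mod_cast hdz
  have hJ0' : (0 : ℝ) < (J0 : ℝ) := by exact_mod_cast hJ0
  have hL' : (0 : ℝ) < (Lmax : ℝ) := by exact_mod_cast hL
  have hUk' : (0 : ℝ) ≤ (Uk : ℝ) := by exact_mod_cast hUk0
  rcases eq_or_lt_of_le hcd with hcd0 | hcd1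
  · refine P.ceilValid_of_degenerate (Or.inr hcd0) (le_trans ?_ hround)
    have hlog : 0 ≤ Real.log (1 + 2 * ((Uk : ℝ) / 2 ^ 40) / ((J0 : ℝ) / (2 * (10 ^ 4 * 2 ^ 40) * (Lmax : ℝ)) * (((b - a : ℤ) : ℝ) / (P.U : ℝ)))) :=
      Real.log_nonneg (by have : (0:ℝ) ≤ 2 * ((Uk : ℝ) / 2 ^ 40) / ((J0 : ℝ) / (2 * (10 ^ 4 * 2 ^ 40) * (Lmax : ℝ)) * (((b - a : ℤ) : ℝ) / (P.U : ℝ))) := by positivity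
                          linarith)
    positivity
  -- main case: the box bound
  have hy : (c : ℝ) / (P.U : ℝ) < (d : ℝ) / (P.U : ℝ) := div_lt_div_of_pos_right (by exact_mod_cast hcd1) hU'
  have hvr : 0 < (Ym.absLo : ℝ) / (10 ^ 4 * 2 ^ 40) := by positivity
  have hmr : 0 ≤ ((max |Yo.lo| |Yo.hi| : ℤ) : ℝ) / (10 ^ 4 * 2 ^ 40) := by positivity
  have hκ : 0 < (J0 : ℝ) / (2 * (10 ^ 4 * 2 ^ 40) * (Lmax : ℝ)) := by positivity
  have hmono := mono_of_absLo_pos Ym hv (S := Icc ((a : ℝ) / (P.U : ℝ)) ((b : ℝ) / (P.U : ℝ)) ×ˢ Icc ((c : ℝ) / (P.U : ℝ)) ((d : ℝ) / (P.U : ℝ)))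
    (φ := e₁y) (fun p hp => hYm p.1 hp.1 p.2 hp.2)
  have hmono' : (∀ x ∈ Icc ((a : ℝ) / (P.U : ℝ)) ((b : ℝ) / (P.U : ℝ)), ∀ y ∈ Icc ((c : ℝ) / (P.U : ℝ)) ((d : ℝ) / (P.U : ℝ)),
        (Ym.absLo : ℝ) / (10 ^ 4 * 2 ^ 40) ≤ e₁y x y) ∨
      (∀ x ∈ Icc ((a : ℝ) / (P.U : ℝ)) ((b : ℝ) / (P.U : ℝ)), ∀ y ∈ Icc ((c : ℝ) / (P.U : ℝ)) ((d : ℝ) / (P.U : ℝ)),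
        e₁y x y ≤ -((Ym.absLo : ℝ) / (10 ^ 4 * 2 ^ 40))) :=
    hmono.imp (fun h x hx y hy => h (x, y) ⟨hx, hy⟩) (fun h x hx y hy => h (x, y) ⟨hx, hy⟩)
  have hm'' : ∀ x ∈ Icc ((a : ℝ) / (P.U : ℝ)) ((b : ℝ) / (P.U : ℝ)), ∀ y ∈ Icc ((c : ℝ) / (P.U : ℝ)) ((d : ℝ) / (P.U : ℝ)),
      |e₂y x y| ≤ ((max |Yo.lo| |Yo.hi| : ℤ) : ℝ) / (10 ^ 4 * 2 ^ 40) :=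
    fun x hx y hy => abs_le_of_scaled Yo (hYo x hx y hy).1 (hYo x hx y hy).2
  obtain ⟨hint, hle⟩ := tip_box_bound (F := fun x y => P.integrand (pt x y)) (e₁ := e₁) (e₂ := e₂) (xs := xs)
    (U₁ := (Uk : ℝ) / 2 ^ 40) hx hy hvr hmr hκ P.measurable_integrand_pt (fun x y => P.integrand_nonneg _)
    (fun x _ y _ => hF x y) he₁ hmono' he₂ hm'' hlow hUk
  refine P.tip_ceilValid_of_box hint hle ?_
  -- match the shape of `tip_rounding`
  have e1 : (b : ℝ) / (P.U : ℝ) - (a : ℝ) / (P.U : ℝ) = ((b - a : ℤ) : ℝ) / (P.U : ℝ) := by push_cast; ring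
  rw [e1]
  exact hround

end OuterX

section OuterY

variable (P : Params) {a b c d : ℤ}

/-- **Abstract tip variant, outer `y`** (slices in `x`; `e₁` the monotone energy). [folklore] -/
theorem Params.tip_valid_outer_y (hP : P.admissible = true) (hab : a ≤ b) (hcd : c < d)
    {e₁ e₂ e₁x e₂x : ℝ → ℝ → ℝ} (he₁ : ∀ x y, HasDerivAt (fun t => e₁ t y) (e₁x x y) x) (he₂ : ∀ x y, HasDerivAt (fun t => e₂ t y) (e₂x x y) x)
    (hF : ∀ x y, P.integrand (pt x y) ≤ 1 / (|e₁ x y| + |e₂ x y|)) (Xm Xo : IV)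
    (hXm : ∀ x ∈ Icc ((a : ℝ) / (P.U : ℝ)) ((b : ℝ) / (P.U : ℝ)), ∀ y ∈ Icc ((c : ℝ) / (P.U : ℝ)) ((d : ℝ) / (P.U : ℝ)),
      (Xm.lo : ℝ) ≤ 10 ^ 4 * 2 ^ 40 * e₁x x y ∧ 10 ^ 4 * 2 ^ 40 * e₁x x y ≤ (Xm.hi : ℝ))
    (hXo : ∀ x ∈ Icc ((a : ℝ) / (P.U : ℝ)) ((b : ℝ) / (P.U : ℝ)), ∀ y ∈ Icc ((c : ℝ) / (P.U : ℝ)) ((d : ℝ) / (P.U : ℝ)),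
      (Xo.lo : ℝ) ≤ 10 ^ 4 * 2 ^ 40 * e₂x x y ∧ 10 ^ 4 * 2 ^ 40 * e₂x x y ≤ (Xo.hi : ℝ))
    (Uk : ℤ) (hUk : ∀ x ∈ Icc ((a : ℝ) / (P.U : ℝ)) ((b : ℝ) / (P.U : ℝ)), ∀ y ∈ Icc ((c : ℝ) / (P.U : ℝ)) ((d : ℝ) / (P.U : ℝ)),
      |e₁ x y| ≤ (Uk : ℝ) / 2 ^ 40)
    (J0 Lmax : ℤ) (hJ0 : 0 < J0) (hL : 0 < Lmax) {ys : ℝ}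
    (hlow : ∀ x ∈ Icc ((a : ℝ) / (P.U : ℝ)) ((b : ℝ) / (P.U : ℝ)), ∀ y ∈ Icc ((c : ℝ) / (P.U : ℝ)) ((d : ℝ) / (P.U : ℝ)),
      (J0 : ℝ) / (2 * (10 ^ 4 * 2 ^ 40) * (Lmax : ℝ)) * |y - ys| ≤ |e₁ x y| + |e₂ x y|)
    {w : ℤ} (hw : P.tipVariant Xm.absLo (max |Xo.lo| |Xo.hi|) (d - c) (logUpZ (cdivZ (4 * Uk * Lmax * P.U * 10 ^ 4 * D) (J0 * (d - c))) + D) = some w) :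
    P.CeilValid a b c d w := by
  obtain ⟨-, -, hU, -, -⟩ := P.admissible_facts hP
  have hU' : (0 : ℝ) < (P.U : ℝ) := by exact_mod_cast hU
  obtain ⟨hv, hm, hdz, rfl⟩ := P.tipVariant_eq_some hw
  set cD : ℝ := 10 ^ 4 * 2 ^ 40 with hcD
  have hy : (c : ℝ) / (P.U : ℝ) < (d : ℝ) / (P.U : ℝ) := div_lt_div_of_pos_right (by exact_mod_cast hcd) hU'
  have hab' : (a : ℝ) / (P.U : ℝ) ≤ (b : ℝ) / (P.U : ℝ) := div_le_div_of_nonneg_right (by exact_mod_cast hab) hU'.le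
  -- Uk ≥ 0 from the (nonempty) closed box
  have hUk0 : 0 ≤ Uk := by
    have h := hUk _ (left_mem_Icc.2 hab') _ (left_mem_Icc.2 hy.le)
    have : (0 : ℝ) ≤ (Uk : ℝ) / 2 ^ 40 := le_trans (abs_nonneg _) h
    have : (0 : ℝ) ≤ (Uk : ℝ) := by
      have := mul_nonneg this (by positivity : (0:ℝ) ≤ 2 ^ 40); simpa using this
    exact_mod_cast this
  have hround := tip_rounding (U := P.U) hv hm hdz hU hJ0 hL hUk0
  -- the real bound is nonnegative ⇒ w ≥ 0 (degenerate case)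
  have hv' : (0 : ℝ) < (Xm.absLo : ℝ) := by exact_mod_cast hv
  have hm' : (0 : ℝ) ≤ ((max |Xo.lo| |Xo.hi| : ℤ) : ℝ) := by exact_mod_cast hm
  have hdz' : (0 : ℝ) < ((d - c : ℤ) : ℝ) := by exact_mod_cast hdz
  have hJ0' : (0 : ℝ) < (J0 : ℝ) := by exact_mod_cast hJ0
  have hL' : (0 : ℝ) < (Lmax : ℝ) := by exact_mod_cast hL
  have hUk' : (0 : ℝ) ≤ (Uk : ℝ) := by exact_mod_cast hUk0
  rcases eq_or_lt_of_le hab with hab0 | hab1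
  · refine P.ceilValid_of_degenerate (Or.inl hab0) (le_trans ?_ hround)
    have hlog : 0 ≤ Real.log (1 + 2 * ((Uk : ℝ) / 2 ^ 40) / ((J0 : ℝ) / (2 * (10 ^ 4 * 2 ^ 40) * (Lmax : ℝ)) * (((d - c : ℤ) : ℝ) / (P.U : ℝ)))) :=
      Real.log_nonneg (by have : (0:ℝ) ≤ 2 * ((Uk : ℝ) / 2 ^ 40) / ((J0 : ℝ) / (2 * (10 ^ 4 * 2 ^ 40) * (Lmax : ℝ)) * (((d - c : ℤ) : ℝ) / (P.U : ℝ))) := by positivity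
                          linarith)
    positivity
  -- main case: the box bound
  have hx : (a : ℝ) / (P.U : ℝ) < (b : ℝ) / (P.U : ℝ) := div_lt_div_of_pos_right (by exact_mod_cast hab1) hU'
  have hvr : 0 < (Xm.absLo : ℝ) / (10 ^ 4 * 2 ^ 40) := by positivity
  have hmr : 0 ≤ ((max |Xo.lo| |Xo.hi| : ℤ) : ℝ) / (10 ^ 4 * 2 ^ 40) := by positivity
  have hκ : 0 < (J0 : ℝ) / (2 * (10 ^ 4 * 2 ^ 40) * (Lmax : ℝ)) := by positivity
  have hmono := mono_of_absLo_pos Xm hv (S := Icc ((a : ℝ) / (P.U : ℝ)) ((b : ℝ) / (P.U : ℝ)) ×ˢ Icc ((c : ℝ) / (P.U : ℝ)) ((d : ℝ) / (P.U : ℝ)))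
    (φ := e₁x) (fun p hp => hXm p.1 hp.1 p.2 hp.2)
  have hmono' : (∀ x ∈ Icc ((a : ℝ) / (P.U : ℝ)) ((b : ℝ) / (P.U : ℝ)), ∀ y ∈ Icc ((c : ℝ) / (P.U : ℝ)) ((d : ℝ) / (P.U : ℝ)),
        (Xm.absLo : ℝ) / (10 ^ 4 * 2 ^ 40) ≤ e₁x x y) ∨
      (∀ x ∈ Icc ((a : ℝ) / (P.U : ℝ)) ((b : ℝ) / (P.U : ℝ)), ∀ y ∈ Icc ((c : ℝ) / (P.U : ℝ)) ((d : ℝ) / (P.U : ℝ)),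
        e₁x x y ≤ -((Xm.absLo : ℝ) / (10 ^ 4 * 2 ^ 40))) :=
    hmono.imp (fun h x hx y hy => h (x, y) ⟨hx, hy⟩) (fun h x hx y hy => h (x, y) ⟨hx, hy⟩)
  have hm'' : ∀ x ∈ Icc ((a : ℝ) / (P.U : ℝ)) ((b : ℝ) / (P.U : ℝ)), ∀ y ∈ Icc ((c : ℝ) / (P.U : ℝ)) ((d : ℝ) / (P.U : ℝ)),
      |e₂x x y| ≤ ((max |Xo.lo| |Xo.hi| : ℤ) : ℝ) / (10 ^ 4 * 2 ^ 40) :=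
    fun x hx y hy => abs_le_of_scaled Xo (hXo x hx y hy).1 (hXo x hx y hy).2
  obtain ⟨hint, hle⟩ := tip_box_bound_swap (F := fun x y => P.integrand (pt x y)) (e₁ := e₁) (e₂ := e₂) (ys := ys)
    (U₁ := (Uk : ℝ) / 2 ^ 40) hx hy hvr hmr hκ P.measurable_integrand_pt (fun x y => P.integrand_nonneg _)
    (fun x _ y _ => hF x y) he₁ hmono' he₂ hm'' hlow hUk
  refine P.tip_ceilValid_of_box hint hle ?_
  -- match the shape of `tip_rounding`
  have e1 : (d : ℝ) / (P.U : ℝ) - (c : ℝ) / (P.U : ℝ) = ((d - c : ℤ) : ℝ) / (P.U : ℝ) := by push_cast; ring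
  rw [e1]
  exact hround

end OuterY

end Summit.HubbardSuperconductivity.HubbardSuperconductivity.Theorems.KlLindhardEnclosure

end
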